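import Mathlib
import HarnessLib
import Summits.NavierStokesRegularity.NavierStokesRegularity.Theorems.QuarterLogPincerTruncationEdgeCore
import Summits.NavierStokesRegularity.NavierStokesRegularity.Theorems.QuarterLogPincerTypeIQuantSubcubicExpTruncationEdgeStubs
import Summits.NavierStokesRegularity.NavierStokesRegularity.Theorems.TypeIQuantSubcubicExp.Negative.ThinCascadeEnvelopeSplit
import Summits.NavierStokesRegularity.NavierStokesRegularity.Theorems.LerayQuarterDissipationFiniteDissipationLiouvilleHardness
import Summits.NavierStokesRegularity.NavierStokesRegularity.Theorems.TypeIQuarterGateScarEnvelopeTypeISatelliteTowerEnvelopeDefs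

/-!
# Route `QuarterLogPincer`, crux `TypeIQuantSubcubicExp` (stmt-NavierStokesRegularity-24077), EDGE line `truncation_edge`:
  THE EDGE — 24077 ⇒ the envelope-class Type-I Liouville wall (item 22144 `FiniteDissipationLiouville`, 24453, 24374,
  (E1⁺) of 23843, the catalogued `TypeIDSSLiouvilleConjecture`), BY NAME, **modulo the single input T1**

Author of every statement and proof below: **ns-idea-7 g8** (line `truncation_edge`, tree copy
`Cruxes/TypeIQuantSubcubicExp/Lines/truncation_edge.lean` v1.3 sha12 `869d7774c0da`; critics idea-crit-4 g5 PASS, idea-crit-7 g3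
backstop, 2026-08-28).  Texts VERBATIM (same namespace, same names), re-homed over the landed modules: Defs p660448, T3 p660348,
T4 p660793 and the by-name stubs `stub_envelopeCubeBudget` / `stub_rateFloor` (`…TruncationEdgeStubs`), the core
`…TruncationEdgeCore`.  Landed by nsreg-C26-p1 g7 (DIRECTOR-NS #259 (2)), `--supports stmt-NavierStokesRegularity-24077` (helper).
The superseded intermediate corollaries `…₂` (modulo T1 ∧ T4) of v1.2 are omitted; everything else is carried.

* `not_typeIQuantSubcubicExp_of_envelopedSingular` — an enveloped singular Type-I ancient mild object refutes the crux
  (given T1, T3, T4); `envelopeLiouville_of_typeIQuantSubcubicExp` — THE EDGE;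
* `finiteDissipationLiouville_of_typeIQuantSubcubicExp` (⇒ item 22144 BY NAME, through the tree's
  `finiteDissipationLiouville_iff_envelopeLiouville`), `envelopedThinLiouville_…`, `asymmetricFlickerLiouville_…` (24453),
  `perpetualFlickerLiouville_…` (24374), `typeIDSSLiouvilleConjecture_…` / `typeIDSSLiouville_…` (the catalogued wall, every
  `λ`), `not_typeIQuantSubcubicExp_of_isTypeIDSSProfile` (THE INSTRUMENT ROW), `noEnvelopedLeaf_…` ((E1⁺) of 23843);
* the `…₁` forms: the same MODULO T1 ONLY, T3 and T4 being tree theorems; `FiniteDissipationLiouville_of₁ :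
  StubFarFieldTruncation → (24077 → 22144)`.

HONEST FRAME: an EDGE (calibration): it PLACES the crux between the thin-cascade Liouville statement S3 (left edge, tree
`typeIQuantSubcubicExp_of_thinCascadeLiouville`) and the envelope-class wall 22144 (right edge, this module, modulo T1); it does
not move it.  24077, 22144, 24453, 24374, 23843, the DSS wall W7 and Navier–Stokes regularity are OPEN / not proved; T1
(`StubFarFieldTruncation`, finite-time far-field truncation stability) is an explicit hypothesis everywhere, asserted nowhere.
-/

noncomputable section

-- the summit-side namespace repeats a component by design (D-0017)
set_option linter.dupNamespace false

namespace Summit.NavierStokesRegularity.NavierStokesRegularity.Cruxes.TypeIQuantSubcubicExp.TruncationEdge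

open MeasureTheory Set Function Metric Filter Topology
open scoped ENNReal NNReal
open Literature.Analysis Literature.Analysis.FluidPDE
open Summit.NavierStokesRegularity.NavierStokesRegularity.Cruxes.TypeIQuantSubcubicExp.ThinCascade
  (TaoFrame ThinObject SingularAt)
open Summit.NavierStokesRegularity.NavierStokesRegularity.Cruxes.ScarEnvelopeTypeI.ZoomDictionary
  (ABTower RegPt EnvelopedLeaf)

/-! ### THE EDGE: the crux implies the envelope-class Liouville statement (modulo T1/T3/T4 as hypotheses) -/

/-- **An enveloped singular Type-I ancient mild object refutes the crux** (given T1, T3, T4). [line theorem of `Cruxes/TypeIQuantSubcubicExp/Lines/truncation_edge.lean` v1.3 (ns-idea-7 g8), verbatim] -/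
theorem not_typeIQuantSubcubicExp_of_envelopedSingular (hT1 : StubFarFieldTruncation)
    (hT3 : StubEnvelopeCubeBudget) (hT4 : StubRateFloor) {M A : ℝ}
    {v : ℝ → EuclideanSpace ℝ (Fin 3) → EuclideanSpace ℝ (Fin 3)}
    (hv : IsTypeIAncientMild M v) (hdec : HasTypeIDecay A v) (hsing : SingularAt v 0) :
    ¬ Summit.NavierStokesRegularity.NavierStokesRegularity.Theses.QuarterLogPincer.TypeIQuantSubcubicExp := by
  -- a negative envelope constant is impossible
  have hA : 0 ≤ A := by
    have h := hdec (-1) (by norm_num) 0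
    simp only [norm_zero, neg_neg, Real.sqrt_one, zero_add, div_one] at h
    exact (norm_nonneg _).trans h
  obtain ⟨K₁, K₂, c, ε₀, hK₂, hc, hε₀, hε₀', hTF⟩ :=
    truncatedFamily_of_parts hA hdec (hT1 M A v hv hdec) (hT3 A v hA hdec) (hT4 M v hv hsing)
  exact not_typeIQuantSubcubicExp_of_truncatedFamily hK₂ hc hε₀ hε₀' hTF

/-- **THE EDGE.** The crux 24077 implies the ENVELOPE-CLASS TYPE-I LIOUVILLE statement: every Type-I
ancient mild field (KNSS gauge, any rate) with a KNSS space–time envelope is regular at the apex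
(the right-hand side of the tree's `finiteDissipationLiouville_iff_envelopeLiouville`). [line theorem of `Cruxes/TypeIQuantSubcubicExp/Lines/truncation_edge.lean` v1.3 (ns-idea-7 g8), verbatim] -/
theorem envelopeLiouville_of_typeIQuantSubcubicExp (hT1 : StubFarFieldTruncation)
    (hT3 : StubEnvelopeCubeBudget) (hT4 : StubRateFloor)
    (h : Summit.NavierStokesRegularity.NavierStokesRegularity.Theses.QuarterLogPincer.TypeIQuantSubcubicExp) :
    ∀ (C A : ℝ) (w : ℝ → EuclideanSpace ℝ (Fin 3) → EuclideanSpace ℝ (Fin 3)),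
      IsTypeIAncientMild C w → HasTypeIDecay A w →
      ¬ (∀ r > 0, ∀ M : ℝ, ∃ t ∈ Ioo (-(r ^ 2)) (0 : ℝ),
          ∃ x ∈ ball (0 : EuclideanSpace ℝ (Fin 3)) r, M < ‖w t x‖) :=
  fun _ _ _ hw hdec hsing => not_typeIQuantSubcubicExp_of_envelopedSingular hT1 hT3 hT4 hw hdec hsing h

/-- **24077 ⇒ 22144** (`LerayQuarterDissipation.FiniteDissipationLiouville`, BY NAME). [line theorem of `Cruxes/TypeIQuantSubcubicExp/Lines/truncation_edge.lean` v1.3 (ns-idea-7 g8), verbatim] -/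
theorem finiteDissipationLiouville_of_typeIQuantSubcubicExp (hT1 : StubFarFieldTruncation)
    (hT3 : StubEnvelopeCubeBudget) (hT4 : StubRateFloor)
    (h : Summit.NavierStokesRegularity.NavierStokesRegularity.Theses.QuarterLogPincer.TypeIQuantSubcubicExp) :
    Summit.NavierStokesRegularity.NavierStokesRegularity.Theses.LerayQuarterDissipation.FiniteDissipationLiouville :=
  Theorems.FiniteDissipationLiouville.Envelope.finiteDissipationLiouville_iff_envelopeLiouville.2
    (envelopeLiouville_of_typeIQuantSubcubicExp hT1 hT3 hT4 h)

/-- «No enveloped thin object» from the crux. [line theorem of `Cruxes/TypeIQuantSubcubicExp/Lines/truncation_edge.lean` v1.3 (ns-idea-7 g8), verbatim] -/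
theorem envelopedThinLiouville_of_typeIQuantSubcubicExp (hT1 : StubFarFieldTruncation)
    (hT3 : StubEnvelopeCubeBudget) (hT4 : StubRateFloor)
    (h : Summit.NavierStokesRegularity.NavierStokesRegularity.Theses.QuarterLogPincer.TypeIQuantSubcubicExp) :
    ∀ (M q A : ℝ) (v : ℝ → EuclideanSpace ℝ (Fin 3) → EuclideanSpace ℝ (Fin 3))
      (g : EuclideanSpace ℝ (Fin 3) → EuclideanSpace ℝ (Fin 3)),
      ThinObject M q v g → HasTypeIDecay A v → False :=
  fun _ _ _ _ _ hthin hdec =>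
    not_typeIQuantSubcubicExp_of_envelopedSingular hT1 hT3 hT4 hthin.1 hdec hthin.2.2.1 h

/-- **24077 ⇒ 24453** (`CalmSliceGate.AsymmetricFlickerLiouville`, BY NAME). [line theorem of `Cruxes/TypeIQuantSubcubicExp/Lines/truncation_edge.lean` v1.3 (ns-idea-7 g8), verbatim] -/
theorem asymmetricFlickerLiouville_of_typeIQuantSubcubicExp (hT1 : StubFarFieldTruncation)
    (hT3 : StubEnvelopeCubeBudget) (hT4 : StubRateFloor)
    (h : Summit.NavierStokesRegularity.NavierStokesRegularity.Theses.QuarterLogPincer.TypeIQuantSubcubicExp) :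
    Summit.NavierStokesRegularity.NavierStokesRegularity.Theses.CalmSliceGate.AsymmetricFlickerLiouville :=
  Theorems.TypeIQuantSubcubicExp.Negative.envelopedThinLiouville_iff_asymmetricFlickerLiouville.1
    (envelopedThinLiouville_of_typeIQuantSubcubicExp hT1 hT3 hT4 h)

/-- **24077 ⇒ 24374** (`CalmSliceGate.PerpetualFlickerLiouville`, BY NAME). [line theorem of `Cruxes/TypeIQuantSubcubicExp/Lines/truncation_edge.lean` v1.3 (ns-idea-7 g8), verbatim] -/
theorem perpetualFlickerLiouville_of_typeIQuantSubcubicExp (hT1 : StubFarFieldTruncation)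
    (hT3 : StubEnvelopeCubeBudget) (hT4 : StubRateFloor)
    (h : Summit.NavierStokesRegularity.NavierStokesRegularity.Theses.QuarterLogPincer.TypeIQuantSubcubicExp) :
    Summit.NavierStokesRegularity.NavierStokesRegularity.Theses.CalmSliceGate.PerpetualFlickerLiouville :=
  Theorems.TypeIQuantSubcubicExp.Negative.envelopedThinLiouville_iff_perpetualFlickerLiouville.1
    (envelopedThinLiouville_of_typeIQuantSubcubicExp hT1 hT3 hT4 h)

/-- **24077 ⇒ the catalogued DSS wall** `TypeIDSSLiouvilleConjecture` (plain and rotated, every `λ`). [line theorem of `Cruxes/TypeIQuantSubcubicExp/Lines/truncation_edge.lean` v1.3 (ns-idea-7 g8), verbatim] -/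
theorem typeIDSSLiouvilleConjecture_of_typeIQuantSubcubicExp (hT1 : StubFarFieldTruncation)
    (hT3 : StubEnvelopeCubeBudget) (hT4 : StubRateFloor)
    (h : Summit.NavierStokesRegularity.NavierStokesRegularity.Theses.QuarterLogPincer.TypeIQuantSubcubicExp) :
    _root_.Summit.NavierStokesRegularity.NavierStokesRegularity.TypeIDSSLiouvilleConjecture :=
  Theorems.FiniteDissipationLiouville.Hardness.typeIDSSLiouvilleConjecture_of_finiteDissipationLiouville
    (finiteDissipationLiouville_of_typeIQuantSubcubicExp hT1 hT3 hT4 h)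

/-- **24077 ⇒ `TypeIDSSLiouville λ`**, every `λ`. [line theorem of `Cruxes/TypeIQuantSubcubicExp/Lines/truncation_edge.lean` v1.3 (ns-idea-7 g8), verbatim] -/
theorem typeIDSSLiouville_of_typeIQuantSubcubicExp (hT1 : StubFarFieldTruncation)
    (hT3 : StubEnvelopeCubeBudget) (hT4 : StubRateFloor)
    (h : Summit.NavierStokesRegularity.NavierStokesRegularity.Theses.QuarterLogPincer.TypeIQuantSubcubicExp)
    (c : ℝ) : TypeIDSSLiouville c :=
  Theorems.FiniteDissipationLiouville.Hardness.typeIDSSLiouville_of_finiteDissipationLiouville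
    (finiteDissipationLiouville_of_typeIQuantSubcubicExp hT1 hT3 hT4 h) c

/-- **THE INSTRUMENT ROW AS A THEOREM**: any Type-I (rotated) `λ`-DSS profile refutes 24077
(modulo T1/T3/T4) — the Negative lane's missing edge. [line theorem of `Cruxes/TypeIQuantSubcubicExp/Lines/truncation_edge.lean` v1.3 (ns-idea-7 g8), verbatim] -/
theorem not_typeIQuantSubcubicExp_of_isTypeIDSSProfile (hT1 : StubFarFieldTruncation)
    (hT3 : StubEnvelopeCubeBudget) (hT4 : StubRateFloor) {c : ℝ}
    {R : EuclideanSpace ℝ (Fin 3) ≃ₗᵢ[ℝ] EuclideanSpace ℝ (Fin 3)}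
    {u : ℝ → EuclideanSpace ℝ (Fin 3) → EuclideanSpace ℝ (Fin 3)} (hu : IsTypeIDSSProfile c R u) :
    ¬ Summit.NavierStokesRegularity.NavierStokesRegularity.Theses.QuarterLogPincer.TypeIQuantSubcubicExp :=
  fun h => Theorems.FiniteDissipationLiouville.Hardness.not_finiteDissipationLiouville_of_isTypeIDSSProfile
    hu (finiteDissipationLiouville_of_typeIQuantSubcubicExp hT1 hT3 hT4 h)

/-! ### (E1⁺) of crux 23843's factorisation from 24077 -/

/-- Not essentially bounded near the apex ⇒ pointwise singular there. [folklore] -/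
theorem singularAt_of_not_regPt {U : ℝ → EuclideanSpace ℝ (Fin 3) → EuclideanSpace ℝ (Fin 3)}
    (h : ¬ RegPt U 0) : SingularAt U 0 := by
  intro r hr B
  by_contra hno
  push Not at hno
  apply h
  refine ⟨r, hr, B, ?_⟩
  have hmeas : MeasurableSet (parabolicCylinder r ((0 : ℝ), (0 : EuclideanSpace ℝ (Fin 3)))) :=
    measurableSet_Ioo.prod measurableSet_ball
  refine (ae_restrict_iff' hmeas).2 (Filter.Eventually.of_forall fun z hz => ?_)
  have hz' : z.1 ∈ Ioo ((0 : ℝ) - r ^ 2) 0 ∧ z.2 ∈ ball (0 : EuclideanSpace ℝ (Fin 3)) r := by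
    simpa only [parabolicCylinder, Set.mem_prod] using hz
  rw [zero_sub] at hz'
  exact hno z.1 hz'.1 z.2 hz'.2

/-- **24077 ⇒ (E1⁺)**: no enveloped leaf of any rate and envelope constant. [line theorem of `Cruxes/TypeIQuantSubcubicExp/Lines/truncation_edge.lean` v1.3 (ns-idea-7 g8), verbatim] -/
theorem noEnvelopedLeaf_of_typeIQuantSubcubicExp (hT1 : StubFarFieldTruncation)
    (hT3 : StubEnvelopeCubeBudget) (hT4 : StubRateFloor)
    (h : Summit.NavierStokesRegularity.NavierStokesRegularity.Theses.QuarterLogPincer.TypeIQuantSubcubicExp) :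
    ∀ M A : ℝ, ¬ EnvelopedLeaf M A := by
  rintro M A ⟨U, P, H, hAB, hdec, h0⟩
  exact not_typeIQuantSubcubicExp_of_envelopedSingular hT1 hT3 hT4 hAB.1 hdec
    (singularAt_of_not_regPt h0) h

/-! ### Compositions BY NAME; the edge MODULO T1 ONLY (T3, T4 are tree theorems) -/

/-- Composition BY NAME over the registered stubs: T1 → T3 → T4 → (24077 → 22144). [line theorem of `Cruxes/TypeIQuantSubcubicExp/Lines/truncation_edge.lean` v1.3 (ns-idea-7 g8), verbatim] -/
theorem FiniteDissipationLiouville_of :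
    StubFarFieldTruncation → StubEnvelopeCubeBudget → StubRateFloor →
      Summit.NavierStokesRegularity.NavierStokesRegularity.Theses.QuarterLogPincer.TypeIQuantSubcubicExp →
      Summit.NavierStokesRegularity.NavierStokesRegularity.Theses.LerayQuarterDissipation.FiniteDissipationLiouville :=
  finiteDissipationLiouville_of_typeIQuantSubcubicExp

/-- **24077 ⇒ item 22144 BY NAME, modulo the single input T1.** [line theorem of `Cruxes/TypeIQuantSubcubicExp/Lines/truncation_edge.lean` v1.3 (ns-idea-7 g8), verbatim] -/
theorem finiteDissipationLiouville_of_typeIQuantSubcubicExp₁ (hT1 : StubFarFieldTruncation)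
    (h : Summit.NavierStokesRegularity.NavierStokesRegularity.Theses.QuarterLogPincer.TypeIQuantSubcubicExp) :
    Summit.NavierStokesRegularity.NavierStokesRegularity.Theses.LerayQuarterDissipation.FiniteDissipationLiouville :=
  finiteDissipationLiouville_of_typeIQuantSubcubicExp hT1 stub_envelopeCubeBudget stub_rateFloor h

/-- **the envelope-class Type-I Liouville statement from 24077, modulo T1.** [line theorem of `Cruxes/TypeIQuantSubcubicExp/Lines/truncation_edge.lean` v1.3 (ns-idea-7 g8), verbatim] -/
theorem envelopeLiouville_of_typeIQuantSubcubicExp₁ (hT1 : StubFarFieldTruncation)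
    (h : Summit.NavierStokesRegularity.NavierStokesRegularity.Theses.QuarterLogPincer.TypeIQuantSubcubicExp) :
    ∀ (C A : ℝ) (w : ℝ → EuclideanSpace ℝ (Fin 3) → EuclideanSpace ℝ (Fin 3)),
      IsTypeIAncientMild C w → HasTypeIDecay A w →
      ¬ (∀ r > 0, ∀ M : ℝ, ∃ t ∈ Ioo (-(r ^ 2)) (0 : ℝ),
          ∃ x ∈ ball (0 : EuclideanSpace ℝ (Fin 3)) r, M < ‖w t x‖) :=
  envelopeLiouville_of_typeIQuantSubcubicExp hT1 stub_envelopeCubeBudget stub_rateFloor h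

/-- **(E1⁺) of 23843 from 24077, modulo T1.** [line theorem of `Cruxes/TypeIQuantSubcubicExp/Lines/truncation_edge.lean` v1.3 (ns-idea-7 g8), verbatim] -/
theorem noEnvelopedLeaf_of_typeIQuantSubcubicExp₁ (hT1 : StubFarFieldTruncation)
    (h : Summit.NavierStokesRegularity.NavierStokesRegularity.Theses.QuarterLogPincer.TypeIQuantSubcubicExp)
    (M A : ℝ) : ¬ EnvelopedLeaf M A :=
  noEnvelopedLeaf_of_typeIQuantSubcubicExp hT1 stub_envelopeCubeBudget stub_rateFloor h M A

/-- **24077 ⇒ the catalogued wall `TypeIDSSLiouvilleConjecture`, modulo T1.** [line theorem of `Cruxes/TypeIQuantSubcubicExp/Lines/truncation_edge.lean` v1.3 (ns-idea-7 g8), verbatim] -/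
theorem typeIDSSLiouvilleConjecture_of_typeIQuantSubcubicExp₁ (hT1 : StubFarFieldTruncation)
    (h : Summit.NavierStokesRegularity.NavierStokesRegularity.Theses.QuarterLogPincer.TypeIQuantSubcubicExp) :
    _root_.Summit.NavierStokesRegularity.NavierStokesRegularity.TypeIDSSLiouvilleConjecture :=
  typeIDSSLiouvilleConjecture_of_typeIQuantSubcubicExp hT1 stub_envelopeCubeBudget stub_rateFloor h

/-- **THE INSTRUMENT ROW modulo T1** — any Type-I (rotated) `λ`-DSS profile refutes 24077, given
only the truncation-stability input T1. [line theorem of `Cruxes/TypeIQuantSubcubicExp/Lines/truncation_edge.lean` v1.3 (ns-idea-7 g8), verbatim] -/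
theorem not_typeIQuantSubcubicExp_of_isTypeIDSSProfile₁ (hT1 : StubFarFieldTruncation) {c : ℝ}
    {R : EuclideanSpace ℝ (Fin 3) ≃ₗᵢ[ℝ] EuclideanSpace ℝ (Fin 3)}
    {u : ℝ → EuclideanSpace ℝ (Fin 3) → EuclideanSpace ℝ (Fin 3)} (hu : IsTypeIDSSProfile c R u) :
    ¬ Summit.NavierStokesRegularity.NavierStokesRegularity.Theses.QuarterLogPincer.TypeIQuantSubcubicExp :=
  not_typeIQuantSubcubicExp_of_isTypeIDSSProfile hT1 stub_envelopeCubeBudget stub_rateFloor hu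

/-- composition BY NAME over the one remaining stub: T1 → (24077 → 22144). [line theorem of `Cruxes/TypeIQuantSubcubicExp/Lines/truncation_edge.lean` v1.3 (ns-idea-7 g8), verbatim] -/
theorem FiniteDissipationLiouville_of₁ :
    StubFarFieldTruncation →
      Summit.NavierStokesRegularity.NavierStokesRegularity.Theses.QuarterLogPincer.TypeIQuantSubcubicExp →
      Summit.NavierStokesRegularity.NavierStokesRegularity.Theses.LerayQuarterDissipation.FiniteDissipationLiouville :=
  finiteDissipationLiouville_of_typeIQuantSubcubicExp₁

end Summit.NavierStokesRegularity.NavierStokesRegularity.Cruxes.TypeIQuantSubcubicExp.TruncationEdge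

end
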